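import Summits.Ventures.GridStability.Lyapunov.StructurePreservingRateState
import Summits.Ventures.GridStability.Lyapunov.ClassicalSwingRate
import HarnessLib

/-!
# GridStability/Lyapunov/ClassicalSwingRateState — «SP-RATE» state form with `gen = univ`: every rotor
# angle and every rotor speed of the lossless classical multimachine model (model-1's `ClassicalSwing`,
# non-uniform damping) converges exponentially at the closed-form rate `vhRate/2` on the certified region

Cell `gridfusion` (LADDER-GRIDFUSION), seat gridfusion-lyap-1 (g7), brief «SP-RATE». Corollary of
`StructurePreservingRateState.lean` (`abs_angle_sub_le_of_sublevel`, `abs_speed_le_of_sublevel`) through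
model-2's dictionary `Params.ofClassical` exactly as in `ClassicalSwingRate.lean`:
* `abs_sub_le` — for every solution `γ` of `M_cl` from `{V ≤ c < c⋆(θ, β)} ∩ window ∩ momentum leaf` and all
  `t ≥ 0`: `|δᵢ(t) − δᵢˢ| ≤ vhGain·√(3V(γ 0)/(hDᵢ))·e^{−(vhRate/2)t}` and
  `|ωᵢ(t)| ≤ √(6·vhGain·V(γ 0)/Mᵢ)·e^{−(vhRate/2)t}` at EVERY machine `i`.
THREE COLUMNS: mathematics about MODEL MV-2L; the constants are explicit but generous (they go through the
D-weighted leaf bound); no certificate data; no sentence here says a grid is stable or well damped. No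
definition, no named fact; standard axioms. [cite: Khalil2002, Theorem 4.10 and Definition 4.5]
-/

noncomputable section

open Set Filter Topology Real Finset
open Summit.Ventures.GridStability.Lyapunov.StructurePreserving
open Summit.Ventures.GridStability.Models.StructurePreserving

namespace Summit.Ventures.GridStability.Lyapunov.ClassicalSwingRate

open Summit.Ventures.GridStability.Models

variable {n : ℕ}

/-- **Exponential convergence of every rotor angle and speed, closed-form rate `vhRate/2`** (MODEL MV-2L,
«SP-RATE» state form with `gen = univ`). Data and region as in `energy_le_mul_exp_neg`; for all `t ≥ 0`
and every machine `i`: `|δᵢ(t) − δᵢˢ| ≤ vhGain·√(3V(γ 0)/(hDᵢ))·e^{−(vhRate/2)t}` and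
`|ωᵢ(t)| ≤ √(6·vhGain·V(γ 0)/Mᵢ)·e^{−(vhRate/2)t}`. No sentence here says a grid is stable or well damped.
[cite: Khalil2002, Theorem 4.10 and Definition 4.5] -/
theorem abs_sub_le (p : ClassicalSwing n) (hl : p.IsLossless)
    (hB : ∀ i j, p.B i j = p.B j i) (hM : ∀ i, 0 < p.M i) (hD : ∀ i, 0 < p.D i) (hn : n ≠ 0)
    (hconn : (Params.ofClassical p).couplingGraph.Preconnected) (hC : ∀ i j, 0 ≤ p.Ccoef i j)
    {β : ℝ} (hβ : 0 < β)
    (hβb : ∀ i j, (Params.ofClassical p).couplingGraph.Adj i j → β ≤ p.Ccoef i j)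
    {δs : Fin n → ℝ} {θ : ℝ} (hθ0 : 0 ≤ θ) (hθ : θ < π / 2)
    (h0 : ∀ i j, p.Ccoef i j ≠ 0 → |δs i - δs j| ≤ θ) (hs : p.IsEquilibrium δs)
    {c : ℝ} (hc : c < levelBound θ β) {h : ℝ} (hh : 0 < h) (hhM : ∀ i, 2 * h * p.M i ≤ p.D i)
    {γ : ℝ → ClassicalSwing.State n} (hγ : p.IsSolutionOn γ univ)
    (hwin : ∀ i j, p.Ccoef i j ≠ 0 → |(γ 0).1 i - (γ 0).1 j| < π / 2)
    (hL : ∑ i, p.M i * (γ 0).2 i + ∑ i, p.D i * (γ 0).1 i = ∑ i, p.D i * δs i)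
    (hV : p.energy δs (γ 0) ≤ c) {t : ℝ} (ht : 0 ≤ t) (i : Fin n) :
    |(γ t).1 i - δs i|
        ≤ vhGain (Params.ofClassical p) β θ h * Real.sqrt (3 * p.energy δs (γ 0) / (h * p.D i))
          * Real.exp (-(vhRate (Params.ofClassical p) β θ h / 2) * t) ∧
      |(γ t).2 i|
        ≤ Real.sqrt (6 * vhGain (Params.ofClassical p) β θ h * p.energy δs (γ 0) / p.M i)
          * Real.exp (-(vhRate (Params.ofClassical p) β θ h / 2) * t) := by
  have hwf : (Params.ofClassical p).WellFormed := Params.wellFormed_ofClassical p hM hD hB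
  have hδ₀ : (Params.ofClassical p).IsSyncEquilibrium δs :=
    Params.isSyncEquilibrium_ofClassical p hl hB hs
  have hb : ∀ i j, 0 ≤ (Params.ofClassical p).b i j := fun i j => hC i j
  have hβb' : ∀ i j, (Params.ofClassical p).couplingGraph.Adj i j →
      β ≤ (Params.ofClassical p).b i j := fun i j hij => hβb i j hij
  have h0' : ∀ i j, (Params.ofClassical p).b i j ≠ 0 → |δs i - δs j| ≤ θ :=
    fun i j hij => h0 i j hij
  have hhM' : ∀ i ∈ (Params.ofClassical p).gen, 2 * h * (Params.ofClassical p).M i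
      ≤ (Params.ofClassical p).D i := fun i _ => by simpa using hhM i
  have hX : ∀ T : ℝ, ∀ t ∈ Icc 0 T,
      HasDerivWithinAt γ (phaseField (Params.ofClassical p) (γ t)) (Icc 0 T) t :=
    fun T t _ => by
      rw [ClassicalSwingRoa.phaseField_ofClassical p hl hB hs (γ t)]
      exact (hγ t (mem_univ t)).mono (subset_univ _)
  have hE : ∀ x : ClassicalSwing.State n,
      phaseEnergy (Params.ofClassical p) δs x = p.energy δs x := fun x => by
    rw [phaseEnergy_apply, Params.ofClassical_energy p hl hB hs x.1 x.2]
  have hy : γ 0 ∈ window (Params.ofClassical p) ∩ constraintSet (Params.ofClassical p) δs ∧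
      phaseEnergy (Params.ofClassical p) δs (γ 0) ≤ c := by
    refine ⟨⟨fun i j hij => hwin i j hij, ?_, fun i hi => absurd (Finset.mem_univ i) ?_⟩, ?_⟩
    · show (Params.ofClassical p).momentum (γ 0).1 (γ 0).2
        = (Params.ofClassical p).momentum δs 0
      simp only [Params.momentum, Params.ofClassical_gen, Params.ofClassical_M,
        Params.ofClassical_D, Pi.zero_apply, mul_zero, Finset.sum_const_zero, zero_add]
      exact hL
    · simp at hi
    · rw [hE]
      exact hV
  refine ⟨?_, ?_⟩
  · have h1 := abs_angle_sub_le_of_sublevel hwf hn hconn hb hβ hβb' hθ0 hθ h0' hδ₀ hc hh hhM' hy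
      hX ht i
    rw [hE] at h1
    simpa using h1
  · have h2 := abs_speed_le_of_sublevel hwf hn hconn hb hβ hβb' hθ0 hθ h0' hδ₀ hc hh hhM' hy
      hX ht (i := i) (by simp)
    rw [hE] at h2
    simpa using h2

end Summit.Ventures.GridStability.Lyapunov.ClassicalSwingRate

end
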